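import Literature.NumberTheory.Transcendental.KZLogCalculusProofs
import Literature.NumberTheory.Transcendental.KZRayDilog
import Literature.NumberTheory.Transcendental.KZDominatedFamilyRelations
import Literature.NumberTheory.Transcendental.KZHomotopyMoves

/-!
# OffTetraSectorKernel (stmt-KontsevichZagierPeriods-10557), line odd-hyperbolic-ladder: tools for stub `stub_raySplit`

Kontsevich–Zagier bookkeeping used by the stub `stub_raySplit` (`log(s r) = −log(1/s) + log r` read
as a chain of moves on two-dimensional representations with the kernel
`F(s, v) = b / (((1 − s a)² + (s b)²) v)`):

* `raySplit_closedBand` — a representation on an OPEN band `{y ∈ G, lo y < v < hi y}` whose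
  integrand agrees there with a function `F` semialgebraic on the CLOSED band is equivalent to the
  closed-band representation `[{y ∈ G, lo y ≤ v ≤ hi y}, F]` (two null graphs; rule (1));
* `raySplit_affine` — the fibrewise dilation `v ↦ s · v` over an open base `G ⊆ {s > 0}` carries
  `[{y ∈ G, lo ≤ v ≤ hi}, F]` to `[{y ∈ G, s·lo ≤ v ≤ s·hi}, F]` (`dv/v` is dilation invariant;
  rule (2), `KZ.of_sub_of_mem_relations_of_affine`);
* semialgebraicity of the kernel, of the base pieces `{0 < s < 1, s r ≷ 1}`, of the edges
  `s ↦ s r`, `s ↦ 1/s`, and the set identity `raySplit_regions` behind the final domain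
  additivity.

References: M. Kontsevich, D. Zagier, *Periods* (2001), §1.1–§1.2.
-/

noncomputable section

open Set MeasureTheory
open Literature.NumberTheory.Transcendental Literature.ModelTheory.ExponentialFields

namespace Summit.KontsevichZagierPeriods.HyperbolicBloch.OffTetraSectorKernel

/-! ### Closing the fibres of an open band -/

/-- **Closing the fibres.** If `Y` is a representation on the open band
`{(y, v) | y ∈ G, lo y < v < hi y}` (edges `lo`, `hi` `ℚ`-semialgebraic on `G`) and its integrand
agrees there with a function `F` which is `ℚ`-semialgebraic on the closed band, then the closed-band
representation `[{y ∈ G, lo y ≤ v ≤ hi y}, F]` exists and is equivalent to `Y`: the two graphs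
`v = lo y`, `v = hi y` are null (rule (1), `KZ.of_sub_of_restrict_openBand_mem_relations`,
`KZ.of_sub_of_mem_relations_of_eqOn`). [cite: KontsevichZagier2001, §1.2 rule (1)] -/
theorem raySplit_closedBand (Y : KZ.IntegralRep 2) {G : Set (Fin 1 → ℝ)}
    {lo hi : (Fin 1 → ℝ) → ℝ} (hlo : IsSemialgebraicFunOn ℚ G lo) (hhi : IsSemialgebraicFunOn ℚ G hi)
    {F : (Fin 2 → ℝ) → ℝ} (hF : IsSemialgebraicFunOn ℚ (KZlog.band G lo hi) F)
    (hYd : Y.domain = {z : Fin 2 → ℝ | (Fin.init z : Fin 1 → ℝ) ∈ G ∧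
      lo (Fin.init z) < z (Fin.last 1) ∧ z (Fin.last 1) < hi (Fin.init z)})
    (hYi : EqOn Y.integrand F Y.domain) :
    ∃ X : KZ.IntegralRep 2, X.domain = KZlog.band G lo hi ∧ X.integrand = F ∧
      KZ.of X - KZ.of Y ∈ KZ.relations := by
  have hband : IsSemialgebraic ℚ (KZlog.band G lo hi) := KZlog.isSemialgebraic_band hlo hhi
  have hsub : Y.domain ⊆ KZlog.band G lo hi := by
    rw [hYd]
    exact fun z hz => ⟨hz.1, hz.2.1.le, hz.2.2.le⟩
  have hnull : volume (KZlog.band G lo hi \ Y.domain) = 0 := by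
    have hcov : KZlog.band G lo hi \ Y.domain ⊆
        {z : Fin 2 → ℝ | (Fin.init z : Fin 1 → ℝ) ∈ G ∧ z (Fin.last 1) = lo (Fin.init z)} ∪
        {z : Fin 2 → ℝ | (Fin.init z : Fin 1 → ℝ) ∈ G ∧ z (Fin.last 1) = hi (Fin.init z)} := by
      intro z hz
      rw [hYd] at hz
      obtain ⟨⟨hzG, h1, h2⟩, hzO⟩ := hz
      simp only [mem_setOf_eq, not_and, not_lt] at hzO
      rcases h1.lt_or_eq with h1 | h1
      · exact Or.inr ⟨hzG, le_antisymm h2 (hzO hzG h1)⟩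
      · exact Or.inl ⟨hzG, h1.symm⟩
    exact measure_mono_null hcov
      (measure_union_null (KZ.volume_graph_eq_zero hlo) (KZ.volume_graph_eq_zero hhi))
  have hint : IntegrableOn F (KZlog.band G lo hi) := by
    have h1 : IntegrableOn F Y.domain :=
      Y.integrableOn.congr_fun hYi (KZ.IntegralRep.measurableSet_domain_holds Y)
    rw [← union_sdiff_cancel hsub]
    exact h1.union (IntegrableOn.of_measure_zero hnull)
  let X : KZ.IntegralRep 2 := ⟨KZlog.band G lo hi, F, hband, hF, hint⟩
  obtain ⟨X', hX'd, hX'i, hrel⟩ := KZ.of_sub_of_restrict_openBand_mem_relations hlo hhi X rfl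
  have hdom : X'.domain = Y.domain := hX'd.trans hYd.symm
  have h2 : KZ.of X' - KZ.of Y ∈ KZ.relations :=
    KZ.of_sub_of_mem_relations_of_eqOn hdom.symm fun z hz => by
      have hz' : z ∈ Y.domain := hdom ▸ hz
      rw [hX'i]
      exact (hYi hz').symm
  refine ⟨X, rfl, rfl, ?_⟩
  have : KZ.of X - KZ.of Y = (KZ.of X - KZ.of X') + (KZ.of X' - KZ.of Y) := by abel
  rw [this]
  exact KZ.relations.add_mem hrel h2

/-! ### The fibrewise dilation `v ↦ s v` -/

/-- **The dilation move.** Over an open `ℚ`-semialgebraic base `G ⊆ {s > 0}` of the `s`-line, the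
substitution `(s, v) ↦ (s, s v)` (Jacobian `s`) carries the band `{lo ≤ v ≤ hi}` onto the band
`{s·lo ≤ v ≤ s·hi}`, and the kernel `F(s, v) = b/(((1 − s a)² + (s b)²) v)` satisfies
`F(s, v) = F(s, s v) · s`; hence `[{lo ≤ v ≤ hi}, F] − [{s lo ≤ v ≤ s hi}, F]` is one instance of
Kontsevich–Zagier's rule (2) (`KZ.of_sub_of_mem_relations_of_affine`).
[cite: KontsevichZagier2001, §1.2 rule (2)] -/
theorem raySplit_affine {a b : ℝ} (F : (Fin 2 → ℝ) → ℝ)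
    (hF : ∀ w, F w = b / ((1 - w 0 * a) ^ 2 + (w 0 * b) ^ 2) / w 1)
    {G : Set (Fin 1 → ℝ)} (hGo : IsOpen G) (hG : IsSemialgebraic ℚ G) (hGpos : ∀ y ∈ G, 0 < y 0)
    {lo hi lo' hi' : (Fin 1 → ℝ) → ℝ} (hlo' : ∀ y ∈ G, lo' y = y 0 * lo y)
    (hhi' : ∀ y ∈ G, hi' y = y 0 * hi y) (N X : KZ.IntegralRep 2)
    (hNd : N.domain = KZlog.band G lo hi) (hNi : N.integrand = F)
    (hXd : X.domain = KZlog.band G lo' hi') (hXi : X.integrand = F) :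
    KZ.of N - KZ.of X ∈ KZ.relations := by
  have hinit : ∀ w : Fin 2 → ℝ, Fin.init w 0 = w 0 := fun _ => rfl
  have hlast : (Fin.last 1 : Fin 2) = 1 := rfl
  have hsnoc0 : ∀ (x : Fin 1 → ℝ) (t : ℝ), (Fin.snoc x t : Fin 2 → ℝ) 0 = x 0 := fun _ _ => rfl
  have hsnoc1 : ∀ (x : Fin 1 → ℝ) (t : ℝ), (Fin.snoc x t : Fin 2 → ℝ) 1 = t := fun _ _ => rfl
  refine KZ.of_sub_of_mem_relations_of_affine hGo (α := fun _ => (0 : ℝ)) (β := fun y => y 0)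
    (by simpa using isSemialgebraicFunOn_ratCast hG 0) (isSemialgebraicFunOn_apply hG 0)
    (differentiableOn_const _)
    (fun y _ => (hasFDerivAt_apply (𝕜 := ℝ) (0 : Fin 1) y).differentiableAt.differentiableWithinAt)
    hGpos N X hNd hXd (fun y hy => by rw [hlo' y hy, zero_add])
    (fun y hy => by rw [hhi' y hy, zero_add]) fun z hz => ?_
  rw [hNd] at hz
  have hs : z 0 ≠ 0 := (hGpos _ hz.1).ne'
  simp only [hNi, hXi, hF, hsnoc0, hsnoc1, hinit, hlast]
  rw [zero_add, mul_comm (z 0) (z 1), ← div_div, div_mul_cancel₀ _ hs]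

/-! ### Semialgebraic data -/

/-- The kernel `F(s, v) = b / (((1 − s a)² + (s b)²) v)` is a `ℚ`-semialgebraic function on the
half-plane `{v > 0}` for real algebraic `a`, `b` with `b ≠ 0` (a quotient by non-vanishing
`ℚ̄`-polynomials; real algebraic constants are `ℚ`-definable). [cite: KontsevichZagier2001, §1.1] -/
theorem raySplit_isSemialgebraicFunOn_kernel {a b : ℝ} (ha : IsAlgebraic ℚ a) (hb : IsAlgebraic ℚ b)
    (hb0 : b ≠ 0) :
    IsSemialgebraicFunOn ℚ {w : Fin 2 → ℝ | 0 < w 1}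
      (fun w => b / ((1 - w 0 * a) ^ 2 + (w 0 * b) ^ 2) / w 1) := by
  have hT : IsSemialgebraic ℚ {w : Fin 2 → ℝ | 0 < w 1} := by
    simpa using isSemialgebraic_setOf_eval_pos (k := ℚ) (R := ℝ)
      (MvPolynomial.X 1 : MvPolynomial (Fin 2) ℚ)
  have h0 := isSemialgebraicFunOn_apply hT 0
  have h1 := isSemialgebraicFunOn_apply hT 1
  have haC := isSemialgebraicFunOn_const_of_isAlgebraic hT ha
  have hbC := isSemialgebraicFunOn_const_of_isAlgebraic hT hb
  have hone : IsSemialgebraicFunOn ℚ {w : Fin 2 → ℝ | 0 < w 1} (fun _ => (1 : ℝ)) := by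
    simpa using isSemialgebraicFunOn_ratCast hT 1
  have hq : IsSemialgebraicFunOn ℚ {w : Fin 2 → ℝ | 0 < w 1}
      (fun w => (1 - w 0 * a) ^ 2 + (w 0 * b) ^ 2) := by
    have e1 := IsSemialgebraicFunOn.sub_holds hone (IsSemialgebraicFunOn.mul_holds h0 haC)
    have e2 := IsSemialgebraicFunOn.mul_holds h0 hbC
    refine (IsSemialgebraicFunOn.add_holds (IsSemialgebraicFunOn.mul_holds e1 e1)
      (IsSemialgebraicFunOn.mul_holds e2 e2)).congr fun w _ => ?_
    simp only [Pi.mul_apply, Pi.add_apply, Pi.sub_apply]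
    ring
  have hq0 : ∀ w ∈ {w : Fin 2 → ℝ | 0 < w 1}, (1 - w 0 * a) ^ 2 + (w 0 * b) ^ 2 ≠ 0 :=
    fun w _ => (KZ.rayDilog_den_pos hb0 a (w 0)).ne'
  exact (hbC.div hq hq0).div h1 fun w hw => ne_of_gt hw

/-- The base piece `{0 < s < 1, 1 < s r}` of the `s`-line is `ℚ`-semialgebraic for real algebraic
`r`. [cite: KontsevichZagier2001, §1.1] -/
theorem raySplit_isSemialgebraic_baseGt {r : ℝ} (hr : IsAlgebraic ℚ r) :
    IsSemialgebraic ℚ {x : Fin 1 → ℝ | (0 < x 0 ∧ x 0 < 1) ∧ 1 < x 0 * r} := by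
  have hσ := isSemialgebraic_unitInterval_fin_one
  have hone : IsSemialgebraicFunOn ℚ {x : Fin 1 → ℝ | 0 < x 0 ∧ x 0 < 1} (fun _ => (1 : ℝ)) := by
    simpa using isSemialgebraicFunOn_ratCast hσ 1
  have h := (IsSemialgebraicFunOn.sub_holds hone (IsSemialgebraicFunOn.mul_holds
    (isSemialgebraicFunOn_apply hσ 0) (isSemialgebraicFunOn_const_of_isAlgebraic hσ hr)))
    |>.isSemialgebraic_sep_neg
  convert h using 1
  ext x
  simp only [mem_setOf_eq, Pi.sub_apply, Pi.mul_apply, sub_neg]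

/-- The base piece `{0 < s < 1, s r < 1}` of the `s`-line is `ℚ`-semialgebraic for real algebraic
`r`. [cite: KontsevichZagier2001, §1.1] -/
theorem raySplit_isSemialgebraic_baseLt {r : ℝ} (hr : IsAlgebraic ℚ r) :
    IsSemialgebraic ℚ {x : Fin 1 → ℝ | (0 < x 0 ∧ x 0 < 1) ∧ x 0 * r < 1} := by
  have hσ := isSemialgebraic_unitInterval_fin_one
  have hone : IsSemialgebraicFunOn ℚ {x : Fin 1 → ℝ | 0 < x 0 ∧ x 0 < 1} (fun _ => (1 : ℝ)) := by
    simpa using isSemialgebraicFunOn_ratCast hσ 1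
  have h := (IsSemialgebraicFunOn.sub_holds (IsSemialgebraicFunOn.mul_holds
    (isSemialgebraicFunOn_apply hσ 0) (isSemialgebraicFunOn_const_of_isAlgebraic hσ hr)) hone)
    |>.isSemialgebraic_sep_neg
  convert h using 1
  ext x
  simp only [mem_setOf_eq, Pi.sub_apply, Pi.mul_apply, sub_neg]

/-- The half-planes `{1 < v}` and `{v < 1}` of the `(s, v)`-plane are `ℚ`-semialgebraic.
[cite: KontsevichZagier2001, §1.1] -/
theorem raySplit_isSemialgebraic_sheets :
    IsSemialgebraic ℚ {w : Fin 2 → ℝ | 1 < w 1} ∧ IsSemialgebraic ℚ {w : Fin 2 → ℝ | w 1 < 1} := by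
  constructor
  · simpa using isSemialgebraic_setOf_eval_lt (k := ℚ) (R := ℝ) 1
      (MvPolynomial.X 1 : MvPolynomial (Fin 2) ℚ)
  · simpa using isSemialgebraic_setOf_eval_lt (k := ℚ) (R := ℝ)
      (MvPolynomial.X 1 : MvPolynomial (Fin 2) ℚ) 1

/-- The edge `s ↦ 1/s` is a `ℚ`-semialgebraic function on any `ℚ`-semialgebraic `D ⊆ {s > 0}`
(a rational function with non-vanishing denominator). [cite: KontsevichZagier2001, §1.1] -/
theorem raySplit_isSemialgebraicFunOn_inv {D : Set (Fin 1 → ℝ)} (hD : IsSemialgebraic ℚ D)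
    (hpos : ∀ x ∈ D, 0 < x 0) : IsSemialgebraicFunOn ℚ D (fun x => 1 / x 0) := by
  have hq : ∀ x ∈ D,
      MvPolynomial.aeval x (MvPolynomial.X 0 : MvPolynomial (Fin 1) ℚ) ≠ 0 := fun x hx => by
    simpa using (hpos x hx).ne'
  refine (isSemialgebraicFunOn_aeval_div_aeval hD 1 (MvPolynomial.X 0) hq).congr fun x _ => ?_
  simp

/-- The edge `s ↦ s r` is a `ℚ`-semialgebraic function on any `ℚ`-semialgebraic `D` for real
algebraic `r`. [cite: KontsevichZagier2001, §1.1] -/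
theorem raySplit_isSemialgebraicFunOn_mulConst {D : Set (Fin 1 → ℝ)} (hD : IsSemialgebraic ℚ D)
    {r : ℝ} (hr : IsAlgebraic ℚ r) : IsSemialgebraicFunOn ℚ D (fun x => x 0 * r) :=
  (IsSemialgebraicFunOn.mul_holds (isSemialgebraicFunOn_apply hD 0)
    (isSemialgebraicFunOn_const_of_isAlgebraic hD hr)).congr fun _ _ => rfl

/-! ### The regions -/

/-- **The signed regions balance.** Over `0 < s < 1`, with closed fibres in `v`:
`{s r < 1, r ≤ v ≤ 1/s} ∪ {1 ≤ v ≤ r} = ({1 ≤ v ≤ 1/s} ∪ {1 < s r, 1/s ≤ v ≤ r}) ∪ {r ≤ v ≤ 1}`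
(`r > 0`): the set identity behind `∫_{sr<…}… = −log(1/s) + log r` fibrewise, i.e. behind the last
domain-additivity step of `stub_raySplit`. [cite: KontsevichZagier2001, §1.2 rule (1)] -/
theorem raySplit_regions :
    ∀ {r : ℝ}, 0 < r →
    KZlog.band {x : Fin 1 → ℝ | (0 < x 0 ∧ x 0 < 1) ∧ x 0 * r < 1} (fun _ => r) (fun x => 1 / x 0) ∪
      KZlog.band {x : Fin 1 → ℝ | 0 < x 0 ∧ x 0 < 1} (fun _ => 1) (fun _ => r) =
    ({w : Fin 2 → ℝ | (0 < w 0 ∧ w 0 < 1) ∧ 1 ≤ w 1 ∧ w 1 ≤ 1 / w 0} ∪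
      KZlog.band {x : Fin 1 → ℝ | (0 < x 0 ∧ x 0 < 1) ∧ 1 < x 0 * r} (fun x => 1 / x 0)
        (fun _ => r)) ∪
      KZlog.band {x : Fin 1 → ℝ | 0 < x 0 ∧ x 0 < 1} (fun _ => r) (fun _ => 1) := by
  intro r hr0
  have hinit : ∀ w : Fin 2 → ℝ, Fin.init w 0 = w 0 := fun _ => rfl
  have hlast : (Fin.last 1 : Fin 2) = 1 := rfl
  ext w
  simp only [mem_union, KZlog.mem_band, mem_setOf_eq, hinit, hlast]
  constructor
  · rintro (⟨⟨⟨hs0, hs1⟩, -⟩, hrv, hvs⟩ | ⟨⟨hs0, hs1⟩, h1v, hvr⟩)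
    · rcases le_total 1 (w 1) with h | h
      · exact Or.inl (Or.inl ⟨⟨hs0, hs1⟩, h, hvs⟩)
      · exact Or.inr ⟨⟨hs0, hs1⟩, hrv, h⟩
    · rcases le_or_gt (w 1) (1 / w 0) with h | h
      · exact Or.inl (Or.inl ⟨⟨hs0, hs1⟩, h1v, h⟩)
      · refine Or.inl (Or.inr ⟨⟨⟨hs0, hs1⟩, ?_⟩, h.le, hvr⟩)
        have h' : 1 / w 0 < r := h.trans_le hvr
        rw [div_lt_iff₀ hs0] at h'
        linarith
  · rintro ((⟨⟨hs0, hs1⟩, h1v, hvs⟩ | ⟨⟨⟨hs0, hs1⟩, -⟩, hsv, hvr⟩) | ⟨⟨hs0, hs1⟩, hrv, hv1⟩)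
    · rcases le_or_gt (w 1) r with h | h
      · exact Or.inr ⟨⟨hs0, hs1⟩, h1v, h⟩
      · refine Or.inl ⟨⟨⟨hs0, hs1⟩, ?_⟩, h.le, hvs⟩
        have h' : r < 1 / w 0 := h.trans_le hvs
        rw [lt_div_iff₀ hs0] at h'
        linarith
    · exact Or.inr ⟨⟨hs0, hs1⟩, (one_lt_one_div hs0 hs1).le.trans hsv, hvr⟩
    · rcases lt_or_ge (w 0 * r) 1 with h | h
      · exact Or.inl ⟨⟨⟨hs0, hs1⟩, h⟩, hrv, hv1.trans (one_lt_one_div hs0 hs1).le⟩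
      · exfalso
        have h' := mul_lt_mul_of_pos_right hs1 hr0
        linarith

end Summit.KontsevichZagierPeriods.HyperbolicBloch.OffTetraSectorKernel

end
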